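import Summits.RiemannHypothesis.RiemannHypothesis.Theorems.WeilWindowFlowWindowLipschitzStubCommutatorBoundAux

/-!
# Edge law by cutting — integration of the archimedean majorant (RH-free)

Part of the pub-rhpf THEORY-2 programme (mechanism / rigidity of the Weil window bottom; no RH
claims). Generic measure theory for the sharp steep-cut upper edge law: the pointwise majorant
of `PfPersistenceEdgeLawCutMajorant` bounds the archimedean integrand `ρ(t) K(t,x)` by
`c(t)(e(x) + e(x+t)) + V(x) f(x+t) + f(x) V(x+t)` (as in Stub E) PLUS four one-sided correlation
products `A₁(x+t) B₁(t,x) + A₂(x) B₂(t,x+t) + A₃(x) B₃(t,x+t) + A₄(x+t) B₄(t,x)` coming from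
Young's inequality in the far singular zone. `cut_arch_le` integrates this:
`∫_{t>0} ρ ∫ K ≤ 2(∫c)(∫e) + 2(∫V)(∫f) + Σᵢ ∫ Aᵢ Ψᵢ` whenever
`∫_{t>0} Bᵢ(t, p ∓ t) dt ≤ Ψᵢ(p)` on the support of `Aᵢ` — Tonelli and translation invariance
(`cut_lintegral_shift`, `cut_lintegral_coshift`). Everything is kept in `ℝ≥0∞` so that no
integrability of the correlation terms is needed.

Sources: E. Bombieri, *Remarks on Weil's quadratic functional in the theory of prime numbers I*,
Rend. Mat. Acc. Lincei (9) 11 (2000) §4 (the archimedean form); folklore measure theory.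
-/

set_option linter.dupNamespace false

noncomputable section

open MeasureTheory Set Filter
open scoped Topology ENNReal NNReal

namespace Summit.RiemannHypothesis.RiemannHypothesis.Theorems.PfPersistence

open Summit.RiemannHypothesis.RiemannHypothesis.Theorems.WeilWindowFlowWindowLipschitz

/-! ## Tonelli with a shift -/

/-- `∫⁻_{t>0} ∫⁻ F(x+t) G(t,x) dx dt = ∫⁻ F(p) (∫⁻_{t>0} G(t, p−t) dt) dp`. [folklore] -/
theorem cut_lintegral_shift {F : ℝ → ℝ≥0∞} {G : ℝ → ℝ → ℝ≥0∞} (hF : Measurable F)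
    (hG : Measurable (Function.uncurry G)) :
    ∫⁻ t in Ioi (0 : ℝ), ∫⁻ x, F (x + t) * G t x = ∫⁻ p, F p * ∫⁻ t in Ioi (0 : ℝ), G t (p - t) := by
  have h1 : ∀ t : ℝ, ∫⁻ x, F (x + t) * G t x = ∫⁻ p, F p * G t (p - t) := fun t ↦ by
    have := lintegral_add_right_eq_self (μ := volume) (fun p ↦ F p * G t (p - t)) t
    simpa only [add_sub_cancel_right] using this
  simp_rw [h1]
  have hmeas : Measurable (Function.uncurry fun t p : ℝ ↦ F p * G t (p - t)) :=
    (hF.comp measurable_snd).mul (hG.comp (measurable_fst.prodMk (measurable_snd.sub measurable_fst)))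
  rw [lintegral_lintegral_swap hmeas.aemeasurable]
  refine lintegral_congr fun p ↦ ?_
  have hm : Measurable fun t ↦ G t (p - t) :=
    hG.comp (measurable_id.prodMk (measurable_const.sub measurable_id))
  rw [lintegral_const_mul _ hm]

/-- `∫⁻_{t>0} ∫⁻ F(x) G(t,x+t) dx dt = ∫⁻ F(x) (∫⁻_{t>0} G(t, x+t) dt) dx`. [folklore] -/
theorem cut_lintegral_coshift {F : ℝ → ℝ≥0∞} {G : ℝ → ℝ → ℝ≥0∞} (hF : Measurable F)
    (hG : Measurable (Function.uncurry G)) :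
    ∫⁻ t in Ioi (0 : ℝ), ∫⁻ x, F x * G t (x + t) = ∫⁻ x, F x * ∫⁻ t in Ioi (0 : ℝ), G t (x + t) := by
  have hmeas : Measurable (Function.uncurry fun t x : ℝ ↦ F x * G t (x + t)) :=
    (hF.comp measurable_snd).mul (hG.comp (measurable_fst.prodMk (measurable_snd.add measurable_fst)))
  rw [lintegral_lintegral_swap hmeas.aemeasurable]
  refine lintegral_congr fun x ↦ ?_
  have hm : Measurable fun t ↦ G t (x + t) :=
    hG.comp (measurable_id.prodMk (measurable_const.add measurable_id))
  rw [lintegral_const_mul _ hm]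

/-- One-sided correlation bound, orientation `A(x+t) B(t,x)`: if `∫_{t>0} B(t, p−t) dt ≤ Ψ(p)`
wherever `A(p) ≠ 0` (`A ≥ 0`), then `∫⁻_{t>0}∫⁻ A(x+t) B(t,x) ≤ ∫⁻ A Ψ`. [folklore] -/
theorem cut_corr_shift_le {A Ψ : ℝ → ℝ} {B : ℝ → ℝ → ℝ} (hAm : Measurable A)
    (hBm : Measurable (Function.uncurry B)) (hA0 : ∀ x, 0 ≤ A x)
    (hΨ : ∀ p, A p ≠ 0 →
      ∫⁻ t in Ioi (0 : ℝ), ENNReal.ofReal (B t (p - t)) ≤ ENNReal.ofReal (Ψ p)) :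
    ∫⁻ t in Ioi (0 : ℝ), ∫⁻ x, ENNReal.ofReal (A (x + t)) * ENNReal.ofReal (B t x) ≤
      ∫⁻ p, ENNReal.ofReal (A p * Ψ p) := by
  rw [cut_lintegral_shift (G := fun t x ↦ ENNReal.ofReal (B t x)) hAm.ennreal_ofReal
    hBm.ennreal_ofReal]
  refine lintegral_mono fun p ↦ ?_
  by_cases hp : A p = 0
  · simp [hp]
  · rw [ENNReal.ofReal_mul (hA0 p)]
    exact mul_le_mul_right (hΨ p hp) _

/-- One-sided correlation bound, orientation `A(x) B(t,x+t)`: if `∫_{t>0} B(t, x+t) dt ≤ Ψ(x)`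
wherever `A(x) ≠ 0` (`A ≥ 0`), then `∫⁻_{t>0}∫⁻ A(x) B(t,x+t) ≤ ∫⁻ A Ψ`. [folklore] -/
theorem cut_corr_coshift_le {A Ψ : ℝ → ℝ} {B : ℝ → ℝ → ℝ} (hAm : Measurable A)
    (hBm : Measurable (Function.uncurry B)) (hA0 : ∀ x, 0 ≤ A x)
    (hΨ : ∀ x, A x ≠ 0 →
      ∫⁻ t in Ioi (0 : ℝ), ENNReal.ofReal (B t (x + t)) ≤ ENNReal.ofReal (Ψ x)) :
    ∫⁻ t in Ioi (0 : ℝ), ∫⁻ x, ENNReal.ofReal (A x) * ENNReal.ofReal (B t (x + t)) ≤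
      ∫⁻ x, ENNReal.ofReal (A x * Ψ x) := by
  rw [cut_lintegral_coshift (G := fun t x ↦ ENNReal.ofReal (B t x)) hAm.ennreal_ofReal
    hBm.ennreal_ofReal]
  refine lintegral_mono fun x ↦ ?_
  by_cases hx : A x = 0
  · simp [hx]
  · rw [ENNReal.ofReal_mul (hA0 x)]
    exact mul_le_mul_right (hΨ x hx) _

/-- `ofReal ∫ F ≤ ∫⁻ ofReal F` (junk value `0` included). [folklore] -/
theorem cut_ofReal_integral_le (μ : Measure ℝ) (F : ℝ → ℝ) :
    ENNReal.ofReal (∫ x, F x ∂μ) ≤ ∫⁻ x, ENNReal.ofReal (F x) ∂μ := by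
  by_cases hF : Integrable F μ
  · calc ENNReal.ofReal (∫ x, F x ∂μ) ≤ ENNReal.ofReal (∫ x, max (F x) 0 ∂μ) :=
          ENNReal.ofReal_le_ofReal (integral_mono hF hF.pos_part fun x ↦ le_max_left _ _)
      _ = ∫⁻ x, ENNReal.ofReal (max (F x) 0) ∂μ :=
          ofReal_integral_eq_lintegral_ofReal hF.pos_part
            (Eventually.of_forall fun x ↦ le_max_right _ _)
      _ = ∫⁻ x, ENNReal.ofReal (F x) ∂μ := lintegral_congr fun x ↦ by simp
  · rw [integral_undef hF, ENNReal.ofReal_zero]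
    exact bot_le

/-! ## The arch integration lemma -/

/-- **Integration of the steep-cut majorant.** If for `t > 0`
`ρ(t) K(t,x) ≤ c(t)(e x + e(x+t)) + V x f(x+t) + f x V(x+t) + A₁(x+t) B₁(t,x) + A₂(x) B₂(t,x+t)
 + A₃(x) B₃(t,x+t) + A₄(x+t) B₄(t,x)` with `c, e, f, V ≥ 0` measurable and integrable,
`Aᵢ ≥ 0` measurable, `Bᵢ` jointly measurable, and the one-dimensional profile bounds
`∫_{t>0} B₁(t,p−t) ≤ Ψ₁(p)` on `{A₁ ≠ 0}`, `∫_{t>0} B₂(t,x+t) ≤ Ψ₂(x)` on `{A₂ ≠ 0}`,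
`∫_{t>0} B₃(t,x+t) ≤ Ψ₃(x)` on `{A₃ ≠ 0}`, `∫_{t>0} B₄(t,p−t) ≤ Ψ₄(p)` on `{A₄ ≠ 0}`, then
`ofReal(∫_{t>0} ρ ∫ K) ≤ ofReal(2(∫c)(∫e) + 2(∫V)(∫f)) + Σᵢ ∫⁻ ofReal(Aᵢ Ψᵢ)`. [folklore] -/
theorem cut_arch_le {ρ c e f V A₁ A₂ A₃ A₄ Ψ₁ Ψ₂ Ψ₃ Ψ₄ : ℝ → ℝ} {B₁ B₂ B₃ B₄ Kf : ℝ → ℝ → ℝ}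
    (hcm : Measurable c) (hem : Measurable e) (hfm : Measurable f) (hVm : Measurable V)
    (hA₁m : Measurable A₁) (hA₂m : Measurable A₂) (hA₃m : Measurable A₃) (hA₄m : Measurable A₄)
    (hB₁m : Measurable (Function.uncurry B₁)) (hB₂m : Measurable (Function.uncurry B₂))
    (hB₃m : Measurable (Function.uncurry B₃)) (hB₄m : Measurable (Function.uncurry B₄))
    (hc0 : ∀ t, 0 ≤ c t) (he0 : ∀ x, 0 ≤ e x) (hf0 : ∀ x, 0 ≤ f x) (hV0 : ∀ x, 0 ≤ V x)
    (hA₁0 : ∀ x, 0 ≤ A₁ x) (hA₂0 : ∀ x, 0 ≤ A₂ x) (hA₃0 : ∀ x, 0 ≤ A₃ x) (hA₄0 : ∀ x, 0 ≤ A₄ x)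
    (hci : Integrable c) (hei : Integrable e) (hfi : Integrable f) (hVi : Integrable V)
    (hΨ₁ : ∀ p, A₁ p ≠ 0 →
      ∫⁻ t in Ioi (0 : ℝ), ENNReal.ofReal (B₁ t (p - t)) ≤ ENNReal.ofReal (Ψ₁ p))
    (hΨ₂ : ∀ x, A₂ x ≠ 0 →
      ∫⁻ t in Ioi (0 : ℝ), ENNReal.ofReal (B₂ t (x + t)) ≤ ENNReal.ofReal (Ψ₂ x))
    (hΨ₃ : ∀ x, A₃ x ≠ 0 →
      ∫⁻ t in Ioi (0 : ℝ), ENNReal.ofReal (B₃ t (x + t)) ≤ ENNReal.ofReal (Ψ₃ x))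
    (hΨ₄ : ∀ p, A₄ p ≠ 0 →
      ∫⁻ t in Ioi (0 : ℝ), ENNReal.ofReal (B₄ t (p - t)) ≤ ENNReal.ofReal (Ψ₄ p))
    (hbound : ∀ t, 0 < t → ∀ x,
      ρ t * Kf t x ≤ c t * (e x + e (x + t)) + V x * f (x + t) + f x * V (x + t) +
        A₁ (x + t) * B₁ t x + A₂ x * B₂ t (x + t) + A₃ x * B₃ t (x + t) + A₄ (x + t) * B₄ t x) :
    ENNReal.ofReal (∫ t in Ioi 0, ρ t * ∫ x, Kf t x) ≤
      ENNReal.ofReal (2 * (∫ t, c t) * (∫ x, e x) + 2 * (∫ x, V x) * (∫ x, f x)) +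
      ((∫⁻ p, ENNReal.ofReal (A₁ p * Ψ₁ p)) + (∫⁻ x, ENNReal.ofReal (A₂ x * Ψ₂ x)) +
        (∫⁻ x, ENNReal.ofReal (A₃ x * Ψ₃ x)) + ∫⁻ p, ENNReal.ofReal (A₄ p * Ψ₄ p)) := by
  -- the four scalar integrals in `ℝ≥0∞`
  have hIc : ∫⁻ t, ENNReal.ofReal (c t) = ENNReal.ofReal (∫ t, c t) :=
    (ofReal_integral_eq_lintegral_ofReal hci (Eventually.of_forall hc0)).symm
  have hIe : ∫⁻ x, ENNReal.ofReal (e x) = ENNReal.ofReal (∫ x, e x) :=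
    (ofReal_integral_eq_lintegral_ofReal hei (Eventually.of_forall he0)).symm
  have hIf : ∫⁻ x, ENNReal.ofReal (f x) = ENNReal.ofReal (∫ x, f x) :=
    (ofReal_integral_eq_lintegral_ofReal hfi (Eventually.of_forall hf0)).symm
  have hIV : ∫⁻ x, ENNReal.ofReal (V x) = ENNReal.ofReal (∫ x, V x) :=
    (ofReal_integral_eq_lintegral_ofReal hVi (Eventually.of_forall hV0)).symm
  have hcE : Measurable fun t ↦ ENNReal.ofReal (c t) := hcm.ennreal_ofReal
  have heE : Measurable fun x ↦ ENNReal.ofReal (e x) := hem.ennreal_ofReal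
  have hfE : Measurable fun x ↦ ENNReal.ofReal (f x) := hfm.ennreal_ofReal
  have hVE : Measurable fun x ↦ ENNReal.ofReal (V x) := hVm.ennreal_ofReal
  have hA₁E : Measurable fun x ↦ ENNReal.ofReal (A₁ x) := hA₁m.ennreal_ofReal
  have hA₂E : Measurable fun x ↦ ENNReal.ofReal (A₂ x) := hA₂m.ennreal_ofReal
  have hA₃E : Measurable fun x ↦ ENNReal.ofReal (A₃ x) := hA₃m.ennreal_ofReal
  have hA₄E : Measurable fun x ↦ ENNReal.ofReal (A₄ x) := hA₄m.ennreal_ofReal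
  -- joint measurability of the seven pieces, as functions of `(t, x)`
  have hst : Measurable fun z : ℝ × ℝ ↦ z.2 + z.1 := measurable_snd.add measurable_fst
  have hJ2 : Measurable (Function.uncurry fun t x : ℝ ↦
      ENNReal.ofReal (V x) * ENNReal.ofReal (f (x + t))) :=
    (hVE.comp measurable_snd).mul (hfE.comp hst)
  have hJ3 : Measurable (Function.uncurry fun t x : ℝ ↦
      ENNReal.ofReal (f x) * ENNReal.ofReal (V (x + t))) :=
    (hfE.comp measurable_snd).mul (hVE.comp hst)
  have hJ4 : Measurable (Function.uncurry fun t x : ℝ ↦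
      ENNReal.ofReal (A₁ (x + t)) * ENNReal.ofReal (B₁ t x)) :=
    (hA₁E.comp hst).mul hB₁m.ennreal_ofReal
  have hJ5 : Measurable (Function.uncurry fun t x : ℝ ↦
      ENNReal.ofReal (A₂ x) * ENNReal.ofReal (B₂ t (x + t))) :=
    (hA₂E.comp measurable_snd).mul ((hB₂m.comp (measurable_fst.prodMk hst)).ennreal_ofReal)
  have hJ6 : Measurable (Function.uncurry fun t x : ℝ ↦
      ENNReal.ofReal (A₃ x) * ENNReal.ofReal (B₃ t (x + t))) :=
    (hA₃E.comp measurable_snd).mul ((hB₃m.comp (measurable_fst.prodMk hst)).ennreal_ofReal)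
  have hJ7 : Measurable (Function.uncurry fun t x : ℝ ↦
      ENNReal.ofReal (A₄ (x + t)) * ENNReal.ofReal (B₄ t x)) :=
    (hA₄E.comp hst).mul hB₄m.ennreal_ofReal
  -- names for the `t`-dependent inner integrals
  set Q₂ : ℝ → ℝ≥0∞ := fun t ↦ ∫⁻ x, ENNReal.ofReal (V x) * ENNReal.ofReal (f (x + t)) with hQ₂
  set Q₃ : ℝ → ℝ≥0∞ := fun t ↦ ∫⁻ x, ENNReal.ofReal (f x) * ENNReal.ofReal (V (x + t)) with hQ₃
  set Q₄ : ℝ → ℝ≥0∞ := fun t ↦ ∫⁻ x, ENNReal.ofReal (A₁ (x + t)) * ENNReal.ofReal (B₁ t x)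
    with hQ₄
  set Q₅ : ℝ → ℝ≥0∞ := fun t ↦ ∫⁻ x, ENNReal.ofReal (A₂ x) * ENNReal.ofReal (B₂ t (x + t))
    with hQ₅
  set Q₆ : ℝ → ℝ≥0∞ := fun t ↦ ∫⁻ x, ENNReal.ofReal (A₃ x) * ENNReal.ofReal (B₃ t (x + t))
    with hQ₆
  set Q₇ : ℝ → ℝ≥0∞ := fun t ↦ ∫⁻ x, ENNReal.ofReal (A₄ (x + t)) * ENNReal.ofReal (B₄ t x)
    with hQ₇
  have hQ₂m : Measurable Q₂ := hJ2.lintegral_prod_right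
  have hQ₃m : Measurable Q₃ := hJ3.lintegral_prod_right
  have hQ₄m : Measurable Q₄ := hJ4.lintegral_prod_right
  have hQ₅m : Measurable Q₅ := hJ5.lintegral_prod_right
  have hQ₆m : Measurable Q₆ := hJ6.lintegral_prod_right
  have hQ₇m : Measurable Q₇ := hJ7.lintegral_prod_right
  -- Step 1: the inner integral, for fixed `t > 0`
  have hstep : ∀ t, 0 < t → ENNReal.ofReal (ρ t * ∫ x, Kf t x) ≤
      ENNReal.ofReal (c t) * (2 * ENNReal.ofReal (∫ x, e x)) +
        (Q₂ t + Q₃ t + Q₄ t + Q₅ t + Q₆ t + Q₇ t) := by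
    intro t ht
    have het : Measurable fun x ↦ ENNReal.ofReal (e (x + t)) :=
      heE.comp (measurable_id.add_const t)
    have hee : Measurable fun x ↦ ENNReal.ofReal (e x) + ENNReal.ofReal (e (x + t)) := heE.add het
    have hm2 : Measurable fun x ↦ ENNReal.ofReal (V x) * ENNReal.ofReal (f (x + t)) :=
      hVE.mul (hfE.comp (measurable_id.add_const t))
    have hm3 : Measurable fun x ↦ ENNReal.ofReal (f x) * ENNReal.ofReal (V (x + t)) :=
      hfE.mul (hVE.comp (measurable_id.add_const t))
    have hm4 : Measurable fun x ↦ ENNReal.ofReal (A₁ (x + t)) * ENNReal.ofReal (B₁ t x) :=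
      (hA₁E.comp (measurable_id.add_const t)).mul
        ((hB₁m.comp (measurable_const.prodMk measurable_id)).ennreal_ofReal)
    have hm5 : Measurable fun x ↦ ENNReal.ofReal (A₂ x) * ENNReal.ofReal (B₂ t (x + t)) :=
      hA₂E.mul ((hB₂m.comp (measurable_const.prodMk (measurable_id.add_const t))).ennreal_ofReal)
    have hm6 : Measurable fun x ↦ ENNReal.ofReal (A₃ x) * ENNReal.ofReal (B₃ t (x + t)) :=
      hA₃E.mul ((hB₃m.comp (measurable_const.prodMk (measurable_id.add_const t))).ennreal_ofReal)
    have hm7 : Measurable fun x ↦ ENNReal.ofReal (A₄ (x + t)) * ENNReal.ofReal (B₄ t x) :=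
      (hA₄E.comp (measurable_id.add_const t)).mul
        ((hB₄m.comp (measurable_const.prodMk measurable_id)).ennreal_ofReal)
    -- pointwise, in `ℝ≥0∞`
    have hpt : ∀ x, ENNReal.ofReal (ρ t * Kf t x) ≤
        ENNReal.ofReal (c t) * (ENNReal.ofReal (e x) + ENNReal.ofReal (e (x + t))) +
          ENNReal.ofReal (V x) * ENNReal.ofReal (f (x + t)) +
          ENNReal.ofReal (f x) * ENNReal.ofReal (V (x + t)) +
          ENNReal.ofReal (A₁ (x + t)) * ENNReal.ofReal (B₁ t x) +
          ENNReal.ofReal (A₂ x) * ENNReal.ofReal (B₂ t (x + t)) +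
          ENNReal.ofReal (A₃ x) * ENNReal.ofReal (B₃ t (x + t)) +
          ENNReal.ofReal (A₄ (x + t)) * ENNReal.ofReal (B₄ t x) := by
      intro x
      rw [← ENNReal.ofReal_add (he0 _) (he0 _), ← ENNReal.ofReal_mul (hc0 _),
        ← ENNReal.ofReal_mul (hV0 _), ← ENNReal.ofReal_mul (hf0 _),
        ← ENNReal.ofReal_mul (hA₁0 _), ← ENNReal.ofReal_mul (hA₂0 _),
        ← ENNReal.ofReal_mul (hA₃0 _), ← ENNReal.ofReal_mul (hA₄0 _)]
      refine (ENNReal.ofReal_le_ofReal (hbound t ht x)).trans ?_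
      refine ENNReal.ofReal_add_le.trans (add_le_add ?_ le_rfl)
      refine ENNReal.ofReal_add_le.trans (add_le_add ?_ le_rfl)
      refine ENNReal.ofReal_add_le.trans (add_le_add ?_ le_rfl)
      refine ENNReal.ofReal_add_le.trans (add_le_add ?_ le_rfl)
      refine ENNReal.ofReal_add_le.trans (add_le_add ?_ le_rfl)
      exact ENNReal.ofReal_add_le
    calc ENNReal.ofReal (ρ t * ∫ x, Kf t x)
        = ENNReal.ofReal (∫ x, ρ t * Kf t x) := by rw [integral_const_mul]
      _ ≤ ∫⁻ x, ENNReal.ofReal (ρ t * Kf t x) := cut_ofReal_integral_le _ _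
      _ ≤ ∫⁻ x, (ENNReal.ofReal (c t) * (ENNReal.ofReal (e x) + ENNReal.ofReal (e (x + t))) +
          ENNReal.ofReal (V x) * ENNReal.ofReal (f (x + t)) +
          ENNReal.ofReal (f x) * ENNReal.ofReal (V (x + t)) +
          ENNReal.ofReal (A₁ (x + t)) * ENNReal.ofReal (B₁ t x) +
          ENNReal.ofReal (A₂ x) * ENNReal.ofReal (B₂ t (x + t)) +
          ENNReal.ofReal (A₃ x) * ENNReal.ofReal (B₃ t (x + t)) +
          ENNReal.ofReal (A₄ (x + t)) * ENNReal.ofReal (B₄ t x)) := lintegral_mono hpt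
      _ = ENNReal.ofReal (c t) * ((∫⁻ x, ENNReal.ofReal (e x)) + ∫⁻ x, ENNReal.ofReal (e (x + t))) +
          (Q₂ t + Q₃ t + Q₄ t + Q₅ t + Q₆ t + Q₇ t) := by
          rw [lintegral_add_right _ hm7, lintegral_add_right _ hm6, lintegral_add_right _ hm5,
            lintegral_add_right _ hm4, lintegral_add_right _ hm3, lintegral_add_right _ hm2,
            lintegral_const_mul _ hee, lintegral_add_left heE]
          simp only [hQ₂, hQ₃, hQ₄, hQ₅, hQ₆, hQ₇, add_assoc]
      _ = _ := by
          rw [lintegral_add_right_eq_self (fun x ↦ ENNReal.ofReal (e x)) t, hIe, two_mul]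
  -- Step 2: integrate in `t`
  have hP₁ : Measurable fun t ↦ ENNReal.ofReal (c t) * (2 * ENNReal.ofReal (∫ x, e x)) :=
    hcE.mul measurable_const
  -- the bound for each `t`-integrated piece
  have hT2 : ∫⁻ t in Ioi (0 : ℝ), Q₂ t ≤ ENNReal.ofReal (∫ x, V x) * ENNReal.ofReal (∫ x, f x) := by
    calc ∫⁻ t in Ioi (0 : ℝ), Q₂ t ≤ ∫⁻ t, Q₂ t := setLIntegral_le_lintegral _ _
      _ = _ := by
          simp only [hQ₂]
          rw [stub_commutatorBound_lintegral_correlation hVE hfE, hIV, hIf]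
  have hT3 : ∫⁻ t in Ioi (0 : ℝ), Q₃ t ≤ ENNReal.ofReal (∫ x, f x) * ENNReal.ofReal (∫ x, V x) := by
    calc ∫⁻ t in Ioi (0 : ℝ), Q₃ t ≤ ∫⁻ t, Q₃ t := setLIntegral_le_lintegral _ _
      _ = _ := by
          simp only [hQ₃]
          rw [stub_commutatorBound_lintegral_correlation hfE hVE, hIV, hIf]
  have hT4 : ∫⁻ t in Ioi (0 : ℝ), Q₄ t ≤ ∫⁻ p, ENNReal.ofReal (A₁ p * Ψ₁ p) :=
    cut_corr_shift_le hA₁m hB₁m hA₁0 hΨ₁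
  have hT5 : ∫⁻ t in Ioi (0 : ℝ), Q₅ t ≤ ∫⁻ x, ENNReal.ofReal (A₂ x * Ψ₂ x) :=
    cut_corr_coshift_le hA₂m hB₂m hA₂0 hΨ₂
  have hT6 : ∫⁻ t in Ioi (0 : ℝ), Q₆ t ≤ ∫⁻ x, ENNReal.ofReal (A₃ x * Ψ₃ x) :=
    cut_corr_coshift_le hA₃m hB₃m hA₃0 hΨ₃
  have hT7 : ∫⁻ t in Ioi (0 : ℝ), Q₇ t ≤ ∫⁻ p, ENNReal.ofReal (A₄ p * Ψ₄ p) :=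
    cut_corr_shift_le hA₄m hB₄m hA₄0 hΨ₄
  have i1 : 0 ≤ ∫ t, c t := integral_nonneg hc0
  have i2 : 0 ≤ ∫ x, e x := integral_nonneg he0
  have i3 : 0 ≤ ∫ x, f x := integral_nonneg hf0
  have i4 : 0 ≤ ∫ x, V x := integral_nonneg hV0
  calc ENNReal.ofReal (∫ t in Ioi 0, ρ t * ∫ x, Kf t x)
      ≤ ∫⁻ t in Ioi 0, ENNReal.ofReal (ρ t * ∫ x, Kf t x) := cut_ofReal_integral_le _ _
    _ ≤ ∫⁻ t in Ioi 0, (ENNReal.ofReal (c t) * (2 * ENNReal.ofReal (∫ x, e x)) +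
          (Q₂ t + Q₃ t + Q₄ t + Q₅ t + Q₆ t + Q₇ t)) :=
        lintegral_mono_ae ((ae_restrict_iff' measurableSet_Ioi).2 (Eventually.of_forall hstep))
    _ = (∫⁻ t in Ioi 0, ENNReal.ofReal (c t) * (2 * ENNReal.ofReal (∫ x, e x))) +
          ((∫⁻ t in Ioi 0, Q₂ t) + (∫⁻ t in Ioi 0, Q₃ t) + (∫⁻ t in Ioi 0, Q₄ t) +
            (∫⁻ t in Ioi 0, Q₅ t) + (∫⁻ t in Ioi 0, Q₆ t) + ∫⁻ t in Ioi 0, Q₇ t) := by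
        rw [lintegral_add_left hP₁, lintegral_add_right _ hQ₇m, lintegral_add_right _ hQ₆m,
          lintegral_add_right _ hQ₅m, lintegral_add_right _ hQ₄m, lintegral_add_right _ hQ₃m]
    _ ≤ (∫⁻ t, ENNReal.ofReal (c t) * (2 * ENNReal.ofReal (∫ x, e x))) +
          (ENNReal.ofReal (∫ x, V x) * ENNReal.ofReal (∫ x, f x) +
            ENNReal.ofReal (∫ x, f x) * ENNReal.ofReal (∫ x, V x) +
            (∫⁻ p, ENNReal.ofReal (A₁ p * Ψ₁ p)) + (∫⁻ x, ENNReal.ofReal (A₂ x * Ψ₂ x)) +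
            (∫⁻ x, ENNReal.ofReal (A₃ x * Ψ₃ x)) + ∫⁻ p, ENNReal.ofReal (A₄ p * Ψ₄ p)) := by
        exact add_le_add (setLIntegral_le_lintegral _ _)
          (add_le_add (add_le_add (add_le_add (add_le_add (add_le_add hT2 hT3) hT4) hT5) hT6) hT7)
    _ = _ := by
        rw [lintegral_mul_const _ hcE, hIc]
        have h2 : (2 : ℝ≥0∞) = ENNReal.ofReal 2 := by simp
        rw [h2, ← ENNReal.ofReal_mul (by norm_num), ← ENNReal.ofReal_mul i1,
          ← ENNReal.ofReal_mul i4, ← ENNReal.ofReal_mul i3]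
        rw [show ENNReal.ofReal (2 * (∫ t, c t) * (∫ x, e x) + 2 * (∫ x, V x) * (∫ x, f x)) =
          ENNReal.ofReal ((∫ t, c t) * (2 * ∫ x, e x)) + (ENNReal.ofReal ((∫ x, V x) * ∫ x, f x) +
            ENNReal.ofReal ((∫ x, f x) * ∫ x, V x)) by
          rw [← ENNReal.ofReal_add (mul_nonneg i4 i3) (mul_nonneg i3 i4),
            ← ENNReal.ofReal_add (mul_nonneg i1 (mul_nonneg zero_le_two i2))
              (add_nonneg (mul_nonneg i4 i3) (mul_nonneg i3 i4))]
          congr 1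
          ring]
        simp only [add_assoc]

end Summit.RiemannHypothesis.RiemannHypothesis.Theorems.PfPersistence

end
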